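import Literature.AlgebraicGeometry.Motives.SplitQuadricConstantFieldExtensions
import HarnessLib

/-!
# Schütt's stable pole order `ν` for the two quadrics of `ℙ^{2l+3}`: `ν_{l+1}(ℰ) = ν_{l+1}(ℋ) = 2 = b_{2l+2}` —
# ALL normalised Frobenius eigenvalues on the middle cohomology are roots of unity; the pole order of
# `Z(ℰ ⊗ 𝔽_{q^m}, T)` at `(q^m)^{−(l+1)}` stabilises at `2` along `2 ∣ m` but along NO cofinal set of all `m`
# (it oscillates `1, 2, 1, 2, …`): the divisibility `m₀ ∣ m` in the stabilisation theorem cannot be dropped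

Topic `Literature/AlgebraicGeometry/Motives`; THEOREMS ONLY (no definition, no instance, no named fact; D-0026).
The tree's `Motives/ZetaFunctionConstantFieldExtensionPoleOrder` proves, for every smooth projective `X` with the
Riemann hypothesis in `E`: there are `ν ≤ b_{2r}`, `ν ≡ b_{2r} (mod 2)`, and `m₀ ≥ 1` with
`ord_{(q^m)^{−r}} Z(X ⊗ 𝔽_{q^m}) = dim H^{2r}(X)(r)_{(φ_r(Fᵐ)),1} = ν` for all `m ≥ 1` DIVISIBLE by `m₀`
(`exists_poleOrder_pow_stable_even`; `ν` = the number of normalised eigenvalues `α/qʳ` of Frobenius on `H^{2r}(X)`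
that are roots of unity, `exists_finrank_maxGenEigenspace_ρTwist_pow_eq_card_isOfFinOrder`). This file computes
these data for the elliptic quadric `ℰ_{2l+3}` and the hyperbolic quadric `ℋ_{2l+3}` (g52-#6, g52-#7) and shows on
`ℰ` that the theorem is sharp:

* §1 (`E`, integral models `P` of the `Pᵢ(ℰ, T)` with RH roots): **`card_isOfFinOrder_roots_ellipticQuadric_middle`**
  (`ν_{l+1}(ℰ) = #{z : P_{2l+2}(ℰ)(z) = 0, z·q^{l+1} ∈ μ_∞} = 2`),
  **`isOfFinOrder_of_mem_roots_ellipticQuadric_middle`** (EVERY normalised inverse root of `P_{2l+2}(ℰ, T)` is a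
  root of unity — they are `±1`), and the same two statements for `ℋ` (`card_isOfFinOrder_roots_splitQuadric_middle`,
  `isOfFinOrder_of_mem_roots_splitQuadric_middle`; all normalised roots `= 1`).
* §2 (explicit stabilisation): **`poleOrder_pow_stable_ellipticQuadric_middle`** (`ν = 2 = b_{2l+2}`, `m₀ = 2`:
  for every `m ≥ 1` with `2 ∣ m`, `dim H^{2l+2}(ℰ)(l+1)_{(φᵐ),1} = 2` and `ord_{(q^m)^{−(l+1)}} Z(ℰ ⊗ 𝔽_{q^m}) = 2`),
  `poleOrder_pow_stable_splitQuadric_middle` (`m₀ = 1` for `ℋ`).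
* §3 (sharpness, E-free): **`not_exists_poleOrder_pow_ellipticQuadric_middle_forall`** (there is NO `ν` with
  `ord_{(q^m)^{−(l+1)}} Z(ℰ ⊗ 𝔽_{q^m}) = ν` for all `m ≥ 1`: orders `1` at `m = 1` and `2` at `m = 2`), versus
  `exists_poleOrder_pow_splitQuadric_middle_forall` (`ν = 2` works for all `m ≥ 1` on `ℋ`); in cohomology
  **`finrank_maxGenEigenspace_ρTwist_pow_ellipticQuadric_middle_three_lt_two`** (`dim …_{(φ³),1} = 1 < 2 = dim …_{(φ²),1}`)
  and **`not_monotone_finrank_maxGenEigenspace_ρTwist_pow_ellipticQuadric_middle`** — the pole order is monotone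
  along divisibility (the tree's `finrank_maxGenEigenspace_ρTwist_pow_mono`) but NOT along `≤`.

HC is not touched.

## References

* [Schuett2013TwoLecturesK3] M. Schütt, Two lectures on the arithmetic of K3 surfaces (2013), §6 pp. 79–80
  (`ρ(X_𝔭)` over `𝔽̄_𝔭` = number of eigenvalues `ζ q`; «`ρ ≡ b₂ mod 2`»).
* [Milne2007TateFiniteFieldsAIM] J. S. Milne, The Tate conjecture over finite fields (AIM talk, 2007), Th. 1.2, p. 4.
* [TateWoodsHole1965] J. Tate, Algebraic cycles and poles of zeta functions (1965), §3.
* [Kahn2020] B. Kahn, Zeta and L-Functions of Varieties and Motives (2020), §6.14 Conj. 6.52; §3.6 Remark 3.66.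
* [Hirschfeld1998] J. W. P. Hirschfeld, Projective Geometries over Finite Fields (1998), §5.2 Thm. 5.2.6 (ii)–(iii).
* [Stichtenoth2009] H. Stichtenoth, Algebraic Function Fields and Codes (2009), Thm. 5.1.15 (f).
* Tree: `Motives/ZetaFunctionConstantFieldExtensionPoleOrder` (`exists_finrank_maxGenEigenspace_ρTwist_pow_eq_card_isOfFinOrder`,
  `exists_poleOrder_pow_stable_even`, `finrank_maxGenEigenspace_ρTwist_pow_mono`), `Motives/EllipticQuadricConstantFieldExtensions`
  (g52-#6), `Motives/SplitQuadricConstantFieldExtensions` (g52-#7), `Motives/QuadricsFiniteFieldCohomology` (g52-#3),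
  `Motives/FrobeniusTracesIndependentOfTheory` (`finrank_eq_natDegree_of_isIntegralModel`).

## Provenance

Lane `lit-hodgefound` (summit `HodgeConjecture`, Track 2 foundations library, Layer B: motives ∕ varieties over finite
fields), seat `lit-hodgefound-p29` (literature-prover, generation 52, row g52-#9).
-/

universe u v

open Polynomial Finset CategoryTheory AlgebraicGeometry
open Literature.AlgebraicGeometry.Kahn2003 (HasPoleOfOrderAt)

noncomputable section

namespace Literature.AlgebraicGeometry.Motives

/-- `l + 1 ≤ 2l + 2 + 2` (any proof matches the tree's by proof irrelevance). [folklore] -/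
private theorem leE (l : ℕ) : l + 1 ≤ 2 * l + 2 + 2 := by omega

/-- The middle coordinate `l + 1`. [folklore] -/
private theorem ltE₁ (l : ℕ) : l + 1 < 2 * l + 2 + 2 := by omega

/-- The middle coordinate `l + 2`. [folklore] -/
private theorem ltE₂ (l : ℕ) : l + 2 < 2 * l + 2 + 2 := by omega

/-- `l + 2 ≤ 2l + 2 + 2`. [folklore] -/
private theorem leS (l : ℕ) : l + 2 ≤ 2 * l + 2 + 2 := by omega

/-! ### §3 (E-free part) The pole order of `ℰ` does not stabilise along all `m`; that of `ℋ` does -/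

section EFree

open SmoothHypersurface (hypersurface)

variable {k : Type u} [Field k] [Finite k] (l : ℕ) {ε : k} (ε' : Fin (l + 2) → kˣ)

/-- **There is NO `ν` with `ord_{T=(q^m)^{−(l+1)}} Z(ℰ ⊗ 𝔽_{q^m}, T) = ν` for ALL `m ≥ 1`**: the order is `1` for
`m = 1` and `2` for `m = 2` (g52-#6). The pole order of the elliptic quadric up the tower `𝔽_{q^m}` oscillates
`1, 2, 1, 2, …`; Schütt's stabilisation holds only along the multiples of `m₀ = 2`. [cite: Schuett2013TwoLecturesK3, §6 pp. 79–80]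
[cite: TateWoodsHole1965, §3] [cite: Hirschfeld1998, §5.2 Thm. 5.2.6 (ii), (iii)] -/
theorem not_exists_poleOrder_pow_ellipticQuadric_middle_forall (hε : ¬IsSquare ε) :
    ¬ ∃ ν : ℕ, ∀ m : ℕ, 0 < m →
      HasPoleOfOrderAt (zetaSeriesPow
        (hypersurface ((∑ i : Fin (l + 1), MvPolynomial.X (Fin.castLE (leE l) i) *
          MvPolynomial.X (Fin.rev (Fin.castLE (leE l) i))) + MvPolynomial.X (Fin.mk (l + 1) (ltE₁ l)) ^ 2 -
          MvPolynomial.C ε * MvPolynomial.X (Fin.mk (l + 2) (ltE₂ l)) ^ 2 : MvPolynomial (Fin (2 * l + 2 + 2)) k)) m)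
        ((((Nat.card k : ℚ) ^ m) ^ (l + 1))⁻¹) ν := by
  rintro ⟨ν, h⟩
  have h1 := (h 1 one_pos).unique (hasPoleOfOrderAt_zetaSeriesPow_ellipticQuadric_middle_of_odd l hε odd_one)
  have h2 := (h 2 two_pos).unique
    (hasPoleOfOrderAt_zetaSeriesPow_ellipticQuadric_middle_of_even l hε two_pos even_two)
  omega

/-- **Along `2 ∣ m` the pole order of `Z(ℰ ⊗ 𝔽_{q^m}, T)` at `(q^m)^{−(l+1)}` IS constant `= 2`** (`m₀ = 2` works).
[cite: Schuett2013TwoLecturesK3, §6 p. 79] [cite: TateWoodsHole1965, §3] -/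
theorem poleOrder_pow_ellipticQuadric_middle_of_two_dvd (hε : ¬IsSquare ε) {m : ℕ} (h2 : 2 ∣ m) (hm : 0 < m) :
    HasPoleOfOrderAt (zetaSeriesPow
        (hypersurface ((∑ i : Fin (l + 1), MvPolynomial.X (Fin.castLE (leE l) i) *
          MvPolynomial.X (Fin.rev (Fin.castLE (leE l) i))) + MvPolynomial.X (Fin.mk (l + 1) (ltE₁ l)) ^ 2 -
          MvPolynomial.C ε * MvPolynomial.X (Fin.mk (l + 2) (ltE₂ l)) ^ 2 : MvPolynomial (Fin (2 * l + 2 + 2)) k)) m)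
      ((((Nat.card k : ℚ) ^ m) ^ (l + 1))⁻¹) 2 :=
  hasPoleOfOrderAt_zetaSeriesPow_ellipticQuadric_middle_of_even l hε hm (even_iff_two_dvd.mpr h2)

/-- For the hyperbolic quadric a single `ν = 2` serves ALL `m ≥ 1` (`m₀ = 1`). [cite: TateWoodsHole1965, §3]
[cite: Schuett2013TwoLecturesK3, §6 p. 79] -/
theorem exists_poleOrder_pow_splitQuadric_middle_forall :
    ∃ ν : ℕ, ∀ m : ℕ, 0 < m →
      HasPoleOfOrderAt (zetaSeriesPow
        (hypersurface (∑ i : Fin (l + 2), MvPolynomial.C (ε' i : k) * MvPolynomial.X (Fin.castLE (leS l) i) *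
          MvPolynomial.X (Fin.rev (Fin.castLE (leS l) i)) : MvPolynomial (Fin (2 * l + 2 + 2)) k)) m)
        ((((Nat.card k : ℚ) ^ m) ^ (l + 1))⁻¹) ν :=
  ⟨2, fun _ hm => hasPoleOfOrderAt_zetaSeriesPow_splitQuadric_middle l ε' hm⟩

end EFree

namespace GaloisWeilCohomology

open SmoothHypersurface (hypersurface)

variable {k : Type u} [Field k] [Finite k] {K : Type v} [Field K] [CharZero K]
  {χ : Field.absoluteGaloisGroup k →* Kˣ} (E : GaloisWeilCohomology k K χ) (l : ℕ) {ε : k} (ε' : Fin (l + 2) → kˣ)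

/-! ### §1 `ν_{l+1}(ℰ) = ν_{l+1}(ℋ) = 2`: all normalised middle Frobenius eigenvalues are roots of unity -/

open Classical in
/-- **`ν_{l+1}(ℰ) = 2`**: for every system of integral models `Pᵢ` of the `Pᵢ(ℰ, T) = det(1 − T·F | Hⁱ(ℰ))` with the
Riemann-hypothesis roots, the number of roots `z` of `P_{2l+2}` with `z·q^{l+1}` a root of unity (Schütt's count of
normalised eigenvalues `α/q^{l+1} ∈ μ_∞`) is `2` — read off at `m = 2m₀` from the tree's stabilisation
`exists_finrank_maxGenEigenspace_ρTwist_pow_eq_card_isOfFinOrder` and g52-#6 (`dim …_{(φᵐ),1} = 2` for `m` even).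
[cite: Schuett2013TwoLecturesK3, §6 pp. 79–80] [cite: Milne2007TateFiniteFieldsAIM, p. 4] [cite: TateWoodsHole1965, §3] -/
theorem card_isOfFinOrder_roots_ellipticQuadric_middle (hE : E.HasLefschetzTraceFormula)
    (hχ : ((χ (arithFrob k) : Kˣ) : K) = Nat.card k) (hε : ¬IsSquare ε)
    {P : Fin (2 * (2 * l + 2) + 1) → ℤ[X]}
    (hP : ∀ i : Fin (2 * (2 * l + 2) + 1), E.IsIntegralModel
      (hypersurface ((∑ i : Fin (l + 1), MvPolynomial.X (Fin.castLE (leE l) i) *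
          MvPolynomial.X (Fin.rev (Fin.castLE (leE l) i))) + MvPolynomial.X (Fin.mk (l + 1) (ltE₁ l)) ^ 2 -
          MvPolynomial.C ε * MvPolynomial.X (Fin.mk (l + 2) (ltE₂ l)) ^ 2 : MvPolynomial (Fin (2 * l + 2 + 2)) k)) i (P i))
    (hroots : ∀ (i : Fin (2 * (2 * l + 2) + 1)) (z : ℂ), ((P i).map (Int.castRingHom ℂ)).IsRoot z →
      ‖z‖ = (Nat.card k : ℝ) ^ (-((i : ℕ) : ℝ) / 2)) :
    Multiset.card ((((P ⟨2 * (l + 1), by omega⟩).map (Int.castRingHom ℂ)).roots.filter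
      fun z => IsOfFinOrder (z * (Nat.card k : ℂ) ^ (l + 1)))) = 2 := by
  have hX := isSmoothProjective_ellipticQuadric_of_not_isSquare l hε
  obtain ⟨m₀, hm₀, h⟩ := E.exists_finrank_maxGenEigenspace_ρTwist_pow_eq_card_isOfFinOrder hE hχ hX hP hroots
    (show l + 1 ≤ 2 * l + 2 by omega)
  rw [← h (2 * m₀) (dvd_mul_left m₀ 2) (by omega),
    E.finrank_maxGenEigenspace_ρTwist_pow_ellipticQuadric_middle l hE hχ hε ⟨P, hP, hroots⟩ (by omega : 0 < 2 * m₀),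
    if_pos (even_two_mul m₀)]

open Classical in
/-- **Every normalised inverse root of `P_{2l+2}(ℰ, T)` is a root of unity** (`ν_{l+1}(ℰ) = b_{2l+2}(ℰ) = 2`; the
roots are `±q^{−(l+1)}`): for an integral model `P_{2l+2}` as above and every complex root `z`, `z·q^{l+1} ∈ μ_∞`.
[cite: Schuett2013TwoLecturesK3, §6 pp. 79–80] [cite: Kahn2020, §3.6 Remark 3.66] -/
theorem isOfFinOrder_of_mem_roots_ellipticQuadric_middle (hE : E.HasLefschetzTraceFormula)
    (hχ : ((χ (arithFrob k) : Kˣ) : K) = Nat.card k) (hε : ¬IsSquare ε)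
    {P : Fin (2 * (2 * l + 2) + 1) → ℤ[X]}
    (hP : ∀ i : Fin (2 * (2 * l + 2) + 1), E.IsIntegralModel
      (hypersurface ((∑ i : Fin (l + 1), MvPolynomial.X (Fin.castLE (leE l) i) *
          MvPolynomial.X (Fin.rev (Fin.castLE (leE l) i))) + MvPolynomial.X (Fin.mk (l + 1) (ltE₁ l)) ^ 2 -
          MvPolynomial.C ε * MvPolynomial.X (Fin.mk (l + 2) (ltE₂ l)) ^ 2 : MvPolynomial (Fin (2 * l + 2 + 2)) k)) i (P i))
    (hroots : ∀ (i : Fin (2 * (2 * l + 2) + 1)) (z : ℂ), ((P i).map (Int.castRingHom ℂ)).IsRoot z →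
      ‖z‖ = (Nat.card k : ℝ) ^ (-((i : ℕ) : ℝ) / 2)) {z : ℂ}
    (hz : z ∈ ((P ⟨2 * (l + 1), by omega⟩).map (Int.castRingHom ℂ)).roots) :
    IsOfFinOrder (z * (Nat.card k : ℂ) ^ (l + 1)) := by
  have hX := isSmoothProjective_ellipticQuadric_of_not_isSquare l hε
  have hcard := E.card_isOfFinOrder_roots_ellipticQuadric_middle l hE hχ hε hP hroots
  -- `#roots ≤ deg P_{2l+2} = b_{2l+2}(ℰ) = 2`
  have hdeg : (P ⟨2 * (l + 1), by omega⟩).natDegree = 2 := by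
    have h := E.finrank_eq_natDegree_of_isIntegralModel hX (i := 2 * (l + 1)) (hP ⟨2 * (l + 1), by omega⟩)
    rw [E.finrank_ellipticQuadric_middle l hE hχ hε ⟨P, hP, hroots⟩] at h
    exact h.symm
  have hle : Multiset.card ((P ⟨2 * (l + 1), by omega⟩).map (Int.castRingHom ℂ)).roots ≤ 2 :=
    (Polynomial.card_roots' _).trans (natDegree_map_le.trans hdeg.le)
  have heq := Multiset.eq_of_le_of_card_le (Multiset.filter_le (fun z => IsOfFinOrder (z * (Nat.card k : ℂ) ^ (l + 1)))
    ((P ⟨2 * (l + 1), by omega⟩).map (Int.castRingHom ℂ)).roots) (by rw [hcard]; exact hle)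
  exact (Multiset.filter_eq_self.mp heq) z hz

/-- `l + 2 ≤ 2l + 2 + 2` (E-level copy). [folklore] -/
private theorem leS' (l : ℕ) : l + 2 ≤ 2 * l + 2 + 2 := by omega

open Classical in
/-- **`ν_{l+1}(ℋ) = 2`** for the hyperbolic quadric (all normalised eigenvalues on `H^{2l+2}(ℋ)` are `1`).
[cite: Schuett2013TwoLecturesK3, §6 pp. 79–80] [cite: TateWoodsHole1965, §3] -/
theorem card_isOfFinOrder_roots_splitQuadric_middle (hE : E.HasLefschetzTraceFormula)
    (hχ : ((χ (arithFrob k) : Kˣ) : K) = Nat.card k)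
    {P : Fin (2 * (2 * l + 2) + 1) → ℤ[X]}
    (hP : ∀ i : Fin (2 * (2 * l + 2) + 1), E.IsIntegralModel
      (hypersurface (∑ i : Fin (l + 2), MvPolynomial.C (ε' i : k) * MvPolynomial.X (Fin.castLE (leS' l) i) *
          MvPolynomial.X (Fin.rev (Fin.castLE (leS' l) i)) : MvPolynomial (Fin (2 * l + 2 + 2)) k)) i (P i))
    (hroots : ∀ (i : Fin (2 * (2 * l + 2) + 1)) (z : ℂ), ((P i).map (Int.castRingHom ℂ)).IsRoot z →
      ‖z‖ = (Nat.card k : ℝ) ^ (-((i : ℕ) : ℝ) / 2)) :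
    Multiset.card ((((P ⟨2 * (l + 1), by omega⟩).map (Int.castRingHom ℂ)).roots.filter
      fun z => IsOfFinOrder (z * (Nat.card k : ℂ) ^ (l + 1)))) = 2 := by
  have hX := isSmoothProjective_splitQuadric l ε'
  obtain ⟨m₀, hm₀, h⟩ := E.exists_finrank_maxGenEigenspace_ρTwist_pow_eq_card_isOfFinOrder hE hχ hX hP hroots
    (show l + 1 ≤ 2 * l + 2 by omega)
  rw [← h m₀ dvd_rfl hm₀, E.finrank_maxGenEigenspace_ρTwist_pow_splitQuadric_middle l ε' hE hχ ⟨P, hP, hroots⟩ m₀]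

open Classical in
/-- **Every normalised inverse root of `P_{2l+2}(ℋ, T)` is a root of unity** (indeed `= 1`).
[cite: Schuett2013TwoLecturesK3, §6 pp. 79–80] [cite: TateWoodsHole1965, §3] -/
theorem isOfFinOrder_of_mem_roots_splitQuadric_middle (hE : E.HasLefschetzTraceFormula)
    (hχ : ((χ (arithFrob k) : Kˣ) : K) = Nat.card k)
    {P : Fin (2 * (2 * l + 2) + 1) → ℤ[X]}
    (hP : ∀ i : Fin (2 * (2 * l + 2) + 1), E.IsIntegralModel
      (hypersurface (∑ i : Fin (l + 2), MvPolynomial.C (ε' i : k) * MvPolynomial.X (Fin.castLE (leS' l) i) *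
          MvPolynomial.X (Fin.rev (Fin.castLE (leS' l) i)) : MvPolynomial (Fin (2 * l + 2 + 2)) k)) i (P i))
    (hroots : ∀ (i : Fin (2 * (2 * l + 2) + 1)) (z : ℂ), ((P i).map (Int.castRingHom ℂ)).IsRoot z →
      ‖z‖ = (Nat.card k : ℝ) ^ (-((i : ℕ) : ℝ) / 2)) {z : ℂ}
    (hz : z ∈ ((P ⟨2 * (l + 1), by omega⟩).map (Int.castRingHom ℂ)).roots) :
    IsOfFinOrder (z * (Nat.card k : ℂ) ^ (l + 1)) := by
  have hX := isSmoothProjective_splitQuadric l ε'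
  have hcard := E.card_isOfFinOrder_roots_splitQuadric_middle l ε' hE hχ hP hroots
  have hdeg : (P ⟨2 * (l + 1), by omega⟩).natDegree = 2 := by
    have h := E.finrank_eq_natDegree_of_isIntegralModel hX (i := 2 * (l + 1)) (hP ⟨2 * (l + 1), by omega⟩)
    rw [E.finrank_splitQuadric_middle l ε' hE hχ ⟨P, hP, hroots⟩] at h
    exact h.symm
  have hle : Multiset.card ((P ⟨2 * (l + 1), by omega⟩).map (Int.castRingHom ℂ)).roots ≤ 2 :=
    (Polynomial.card_roots' _).trans (natDegree_map_le.trans hdeg.le)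
  have heq := Multiset.eq_of_le_of_card_le (Multiset.filter_le (fun z => IsOfFinOrder (z * (Nat.card k : ℂ) ^ (l + 1)))
    ((P ⟨2 * (l + 1), by omega⟩).map (Int.castRingHom ℂ)).roots) (by rw [hcard]; exact hle)
  exact (Multiset.filter_eq_self.mp heq) z hz

/-! ### §2 The stabilisation data made explicit: `ν = 2`, `m₀ = 2` for `ℰ`, `m₀ = 1` for `ℋ` -/

/-- **Explicit Schütt stabilisation for `ℰ`: `ν_{l+1} = 2 = b_{2l+2}`, `m₀ = 2`** — for every `m ≥ 1` with `2 ∣ m`,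
`dim H^{2l+2}(ℰ)(l+1)_{(φ_{l+1}(Fᵐ)),1} = 2` and `Z(ℰ ⊗ 𝔽_{q^m}, T)` has a pole of order exactly `2` at
`(q^m)^{−(l+1)}` (the tree's `exists_poleOrder_pow_stable_even` with its witnesses named; `ν ≡ b (mod 2)` as `2 ≡ 2`).
[cite: Schuett2013TwoLecturesK3, §6 pp. 79–80] [cite: Milne2007TateFiniteFieldsAIM, Th. 1.2] [cite: TateWoodsHole1965, §3] -/
theorem poleOrder_pow_stable_ellipticQuadric_middle (hE : E.HasLefschetzTraceFormula)
    (hχ : ((χ (arithFrob k) : Kˣ) : K) = Nat.card k) (hε : ¬IsSquare ε)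
    (hRH : E.WeilRiemannHypothesisFor
      (hypersurface ((∑ i : Fin (l + 1), MvPolynomial.X (Fin.castLE (leE l) i) *
          MvPolynomial.X (Fin.rev (Fin.castLE (leE l) i))) + MvPolynomial.X (Fin.mk (l + 1) (ltE₁ l)) ^ 2 -
          MvPolynomial.C ε * MvPolynomial.X (Fin.mk (l + 2) (ltE₂ l)) ^ 2 : MvPolynomial (Fin (2 * l + 2 + 2)) k)) (2 * l + 2)) :
    ∀ m : ℕ, 2 ∣ m → 0 < m →
      Module.finrank K (Module.End.maxGenEigenspace (E.ρTwist
        (hypersurface ((∑ i : Fin (l + 1), MvPolynomial.X (Fin.castLE (leE l) i) *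
          MvPolynomial.X (Fin.rev (Fin.castLE (leE l) i))) + MvPolynomial.X (Fin.mk (l + 1) (ltE₁ l)) ^ 2 -
          MvPolynomial.C ε * MvPolynomial.X (Fin.mk (l + 2) (ltE₂ l)) ^ 2 : MvPolynomial (Fin (2 * l + 2 + 2)) k)) (2 * (l + 1)) (l + 1 : ℕ) (geomFrob k ^ m)) 1) = 2 ∧
      HasPoleOfOrderAt (zetaSeriesPow
        (hypersurface ((∑ i : Fin (l + 1), MvPolynomial.X (Fin.castLE (leE l) i) *
          MvPolynomial.X (Fin.rev (Fin.castLE (leE l) i))) + MvPolynomial.X (Fin.mk (l + 1) (ltE₁ l)) ^ 2 -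
          MvPolynomial.C ε * MvPolynomial.X (Fin.mk (l + 2) (ltE₂ l)) ^ 2 : MvPolynomial (Fin (2 * l + 2 + 2)) k)) m)
        ((((Nat.card k : ℚ) ^ m) ^ (l + 1))⁻¹) 2 := by
  intro m h2 hm
  refine ⟨?_, poleOrder_pow_ellipticQuadric_middle_of_two_dvd l hε h2 hm⟩
  rw [E.finrank_maxGenEigenspace_ρTwist_pow_ellipticQuadric_middle l hE hχ hε hRH hm,
    if_pos (even_iff_two_dvd.mpr h2)]

/-- **For `ℋ` the stabilisation holds from `m₀ = 1`: `ν_{l+1} = 2 = b_{2l+2}`** for every `m ≥ 1`.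
[cite: Schuett2013TwoLecturesK3, §6 pp. 79–80] [cite: TateWoodsHole1965, §3] -/
theorem poleOrder_pow_stable_splitQuadric_middle (hE : E.HasLefschetzTraceFormula)
    (hχ : ((χ (arithFrob k) : Kˣ) : K) = Nat.card k)
    (hRH : E.WeilRiemannHypothesisFor
      (hypersurface (∑ i : Fin (l + 2), MvPolynomial.C (ε' i : k) * MvPolynomial.X (Fin.castLE (leS' l) i) *
          MvPolynomial.X (Fin.rev (Fin.castLE (leS' l) i)) : MvPolynomial (Fin (2 * l + 2 + 2)) k)) (2 * l + 2)) :
    ∀ m : ℕ, 1 ∣ m → 0 < m →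
      Module.finrank K (Module.End.maxGenEigenspace (E.ρTwist
        (hypersurface (∑ i : Fin (l + 2), MvPolynomial.C (ε' i : k) * MvPolynomial.X (Fin.castLE (leS' l) i) *
          MvPolynomial.X (Fin.rev (Fin.castLE (leS' l) i)) : MvPolynomial (Fin (2 * l + 2 + 2)) k)) (2 * (l + 1)) (l + 1 : ℕ) (geomFrob k ^ m)) 1) = 2 ∧
      HasPoleOfOrderAt (zetaSeriesPow
        (hypersurface (∑ i : Fin (l + 2), MvPolynomial.C (ε' i : k) * MvPolynomial.X (Fin.castLE (leS' l) i) *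
          MvPolynomial.X (Fin.rev (Fin.castLE (leS' l) i)) : MvPolynomial (Fin (2 * l + 2 + 2)) k)) m)
        ((((Nat.card k : ℚ) ^ m) ^ (l + 1))⁻¹) 2 :=
  fun m _ hm => ⟨E.finrank_maxGenEigenspace_ρTwist_pow_splitQuadric_middle l ε' hE hχ hRH m,
    hasPoleOfOrderAt_zetaSeriesPow_splitQuadric_middle l ε' hm⟩

/-! ### §3 (E-level part) Non-monotonicity of `m ↦ dim H^{2l+2}(ℰ)(l+1)_{(φᵐ),1}` -/

/-- **`dim H^{2l+2}(ℰ)(l+1)_{(φ³),1} = 1 < 2 = dim H^{2l+2}(ℰ)(l+1)_{(φ²),1}`**: passing from `𝔽_{q²}` to `𝔽_{q³}`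
LOSES a Tate class (the second ruling is rational over `𝔽_{q²}` but not over `𝔽_{q³}`). [cite: Schuett2013TwoLecturesK3, §6 p. 79]
[cite: Kahn2020, §3.6 Remark 3.66] [cite: Hirschfeld1998, §5.2 Thm. 5.2.6 (iii)] -/
theorem finrank_maxGenEigenspace_ρTwist_pow_ellipticQuadric_middle_three_lt_two (hE : E.HasLefschetzTraceFormula)
    (hχ : ((χ (arithFrob k) : Kˣ) : K) = Nat.card k) (hε : ¬IsSquare ε)
    (hRH : E.WeilRiemannHypothesisFor
      (hypersurface ((∑ i : Fin (l + 1), MvPolynomial.X (Fin.castLE (leE l) i) *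
          MvPolynomial.X (Fin.rev (Fin.castLE (leE l) i))) + MvPolynomial.X (Fin.mk (l + 1) (ltE₁ l)) ^ 2 -
          MvPolynomial.C ε * MvPolynomial.X (Fin.mk (l + 2) (ltE₂ l)) ^ 2 : MvPolynomial (Fin (2 * l + 2 + 2)) k)) (2 * l + 2)) :
    Module.finrank K (Module.End.maxGenEigenspace (E.ρTwist
        (hypersurface ((∑ i : Fin (l + 1), MvPolynomial.X (Fin.castLE (leE l) i) *
          MvPolynomial.X (Fin.rev (Fin.castLE (leE l) i))) + MvPolynomial.X (Fin.mk (l + 1) (ltE₁ l)) ^ 2 -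
          MvPolynomial.C ε * MvPolynomial.X (Fin.mk (l + 2) (ltE₂ l)) ^ 2 : MvPolynomial (Fin (2 * l + 2 + 2)) k)) (2 * (l + 1)) (l + 1 : ℕ) (geomFrob k ^ 3)) 1) <
      Module.finrank K (Module.End.maxGenEigenspace (E.ρTwist
        (hypersurface ((∑ i : Fin (l + 1), MvPolynomial.X (Fin.castLE (leE l) i) *
          MvPolynomial.X (Fin.rev (Fin.castLE (leE l) i))) + MvPolynomial.X (Fin.mk (l + 1) (ltE₁ l)) ^ 2 -
          MvPolynomial.C ε * MvPolynomial.X (Fin.mk (l + 2) (ltE₂ l)) ^ 2 : MvPolynomial (Fin (2 * l + 2 + 2)) k)) (2 * (l + 1)) (l + 1 : ℕ) (geomFrob k ^ 2)) 1) := by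
  rw [E.finrank_maxGenEigenspace_ρTwist_pow_ellipticQuadric_middle l hE hχ hε hRH three_pos,
    E.finrank_maxGenEigenspace_ρTwist_pow_ellipticQuadric_middle l hE hχ hε hRH two_pos,
    if_neg (by decide), if_pos even_two]
  exact one_lt_two

/-- **`m ↦ dim H^{2l+2}(ℰ)(l+1)_{(φ_{l+1}(Fᵐ)),1}` (= `ord_{(q^m)^{−(l+1)}} Z(ℰ ⊗ 𝔽_{q^m})` for `m ≥ 1`) is NOT
monotone in `m`** — it is monotone only along divisibility (the tree's `finrank_maxGenEigenspace_ρTwist_pow_mono`).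
[cite: Schuett2013TwoLecturesK3, §6 p. 79] [cite: Stichtenoth2009, Theorem 5.1.15 (f)] -/
theorem not_monotone_finrank_maxGenEigenspace_ρTwist_pow_ellipticQuadric_middle (hE : E.HasLefschetzTraceFormula)
    (hχ : ((χ (arithFrob k) : Kˣ) : K) = Nat.card k) (hε : ¬IsSquare ε)
    (hRH : E.WeilRiemannHypothesisFor
      (hypersurface ((∑ i : Fin (l + 1), MvPolynomial.X (Fin.castLE (leE l) i) *
          MvPolynomial.X (Fin.rev (Fin.castLE (leE l) i))) + MvPolynomial.X (Fin.mk (l + 1) (ltE₁ l)) ^ 2 -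
          MvPolynomial.C ε * MvPolynomial.X (Fin.mk (l + 2) (ltE₂ l)) ^ 2 : MvPolynomial (Fin (2 * l + 2 + 2)) k)) (2 * l + 2)) :
    ¬ Monotone (fun m : ℕ => Module.finrank K (Module.End.maxGenEigenspace (E.ρTwist
        (hypersurface ((∑ i : Fin (l + 1), MvPolynomial.X (Fin.castLE (leE l) i) *
          MvPolynomial.X (Fin.rev (Fin.castLE (leE l) i))) + MvPolynomial.X (Fin.mk (l + 1) (ltE₁ l)) ^ 2 -
          MvPolynomial.C ε * MvPolynomial.X (Fin.mk (l + 2) (ltE₂ l)) ^ 2 : MvPolynomial (Fin (2 * l + 2 + 2)) k)) (2 * (l + 1)) (l + 1 : ℕ) (geomFrob k ^ m)) 1)) := by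
  intro hmono
  have h := hmono (show 2 ≤ 3 by omega)
  exact absurd (E.finrank_maxGenEigenspace_ρTwist_pow_ellipticQuadric_middle_three_lt_two l hE hχ hε hRH)
    (not_lt.mpr h)

end GaloisWeilCohomology

end Literature.AlgebraicGeometry.Motives

end
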